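import Mathlib
import Literature.NumberTheory.LFunctions.Zhang2022.Section10Range1113Top
import Literature.NumberTheory.LFunctions.Zhang2022.Section10Range1321MidRel
import Literature.NumberTheory.LFunctions.Zhang2022.Section10CRanges1422
import Literature.NumberTheory.LFunctions.Zhang2022.Section10Lemma102Windows
import Literature.NumberTheory.LFunctions.Zhang2022.AppendixALemma83RelHolds
import HarnessLib

/-!
# Zhang (2022) §10 p. 57: the middle range of `Θ₁(𝐚₁₁,𝐚₁₃)` — node `Z22:§10.u037` (first line)
# as a kernel EDGE from the RELATIVE Lemma 10.2 (clauses (10.9) and (10.11) weighted)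

Topic `Literature/NumberTheory/LFunctions/Zhang2022` (Landau–Siegel audit tree; verdict-neutral).
Y. Zhang, *Discrete mean estimates and the Landau–Siegel zero*, arXiv:2211.02515v1 (2022)
[Zhang2022LandauSiegel], §10 p. 57 (tex L2925–2945) — **an unrefereed manuscript under
adjudication; nothing here bears on its Theorems 1–2 or on Landau–Siegel zeros.** ZHANG-L discharge
lane (WP10, seat zl-w10-p3), leaf `Typed.Sec10B.Concl1113` (v19 binder hC1113); companion of sz-d41's
`Skeleton.eq1037a_of` (Section10Range1113), which takes the ABSOLUTE Lemma 10.2 `Skeleton.Lemma102 c′`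
— re-typed by RT-01′ (HOME/RETYPE-LEDGER.md; GAP rows G-d43-1, G-d60-1) to the RELATIVE form whose
clauses carry the factor `(∏_{q∣dr}(1 − q⁻¹)⁻¹)² = (dr/φ(dr))²`.

What is PROVED here (kernel-checked; theorem-only, no new definitions, no named facts):

* `final_bound_gen` — the numeric endgame, generic in the weight constants;
* `eq1037a_of_clauses` — **`Typed.Sec10B.Eq1037a c′` ⇐ clause (10.9) of Lemma 10.2 in RELATIVE form
  ∧ the window clause (10.11) in the WEIGHTED form of record (RT-01′/R-26)
  `‖𝔳₂ⱼ(d,r)‖ ≤ C·𝓛(1 + log T)⁴/log P·(∏_{q∣dr}(1−q⁻¹)⁻¹)²`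
  ∧ Lemma 8.2 (`Skeleton.Lemma82 c′`) ∧ (8.10) (`Section8cStatements.Eq810`)** — the two Lemma-10.2
  clauses are taken as EXPLICIT hypotheses spelled exactly as in `Skeleton.Lemma102Rel` (clause 2) and
  in the RT-01′ weighted window clause, so that the edge instantiates from whichever relative Lemma 10.2
  node the skeleton carries (`Lemma102RelW`); the relative tolerance `(n/φ(n))²` is absorbed by raising
  the mass exponent of the window weights from `(n/φ(n))⁵` to `(n/φ(n))⁷` (L3-t4's relative assembly
  `Typed.Sec10C.Ranges1422.range_assembly_bound₃`, sz-d33's weights `Sj1321Mid.weight_good_le` /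
  and the SHARP window mass `Skeleton.weight_sum_windows 7`, `≤ e^{256}(5 + 𝓛^{1.1})`); total error
  `≪ 𝓛⁻¹³ + 𝓛^{1.1}·𝓛^{5.5}·𝓛⁻¹⁶ = O(𝓛^{−9.4}) = o(α)`;
* `Typed.Sec10B.eq1037a_holds : 0 ≤ c′ → Eq1037a c′` — **Z22:§10.u037 (i) HOLDS** (every input of
  `eq1037a_of_clauses` is a tree theorem: zl-w10-p6's `Lemma102.eq109Rel_of_lemma83Rel`,
  `Lemma102.frakv2_windows_le_of_lemma83Rel`; WP09's `Skeleton.lemma83Rel_holds`; `lemma82_holds`,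
  `eq810_holds`).

## References

* Y. Zhang, arXiv:2211.02515v1 (2022), §10 p. 57; Lemma 10.2 p. 55; §8 Lemma 8.2 p. 46, (8.10) p. 48.
  [cite: Zhang2022LandauSiegel, §10 p. 57]
-/

noncomputable section

open Complex Real Finset

namespace Literature.NumberTheory.LFunctions.Zhang2022.Range1113Rel

open Skeleton Typed
open Literature.NumberTheory.LFunctions.Zhang2022.Section8cProofs (large_D)

/-! ## The numeric endgame with exponent-7 weights -/

/-- The final numeric step, generic in the weight constants: `W₁A₁ + W₂A₂ ≤ επ𝓛⁻⁹` for
`W₁ ≤ w₁𝓛⁹`, `W₂ ≤ w₂𝓛²`, `A₁ ≤ K₁𝓛⁻²²`, `A₂ ≤ K₂𝓛⁻¹²`, once `𝓛 ≥ (w₁K₁ + w₂K₂)/(επ)` and `𝓛 ≥ 1`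
(total `≤ (w₁K₁ + w₂K₂)𝓛⁻¹⁰`). [cite: Zhang2022LandauSiegel, §10 p. 57] -/
theorem final_bound_gen {L ε K₁ K₂ W₁ W₂ A₁ A₂ w₁ w₂ : ℝ} (hL1 : 1 ≤ L) (hε : 0 < ε)
    (hK₁ : 0 ≤ K₁) (hK₂ : 0 ≤ K₂) (hw₁ : 0 ≤ w₁) (hw₂ : 0 ≤ w₂) (hA₁0 : 0 ≤ A₁) (hA₂0 : 0 ≤ A₂)
    (hW₁ : W₁ ≤ w₁ * L ^ 9) (hW₂ : W₂ ≤ w₂ * L ^ 2)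
    (hA₁ : A₁ ≤ K₁ * (L ^ 22)⁻¹) (hA₂ : A₂ ≤ K₂ * (L ^ 12)⁻¹)
    (hLX : (w₁ * K₁ + w₂ * K₂) / (ε * π) ≤ L) :
    W₁ * A₁ + W₂ * A₂ ≤ ε * (π / L ^ 9) := by
  have hL0 : 0 < L := by linarith
  set K : ℝ := w₁ * K₁ + w₂ * K₂ with hK
  have hK0 : 0 ≤ K := by positivity
  have step1 : W₁ * A₁ + W₂ * A₂ ≤
      (w₁ * L ^ 9) * (K₁ * (L ^ 22)⁻¹) + (w₂ * L ^ 2) * (K₂ * (L ^ 12)⁻¹) := by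
    gcongr
  have e1 : w₁ * L ^ 9 * (K₁ * (L ^ 22)⁻¹) = w₁ * K₁ * (L ^ 13)⁻¹ := by
    field_simp
  have e2 : w₂ * L ^ 2 * (K₂ * (L ^ 12)⁻¹) = w₂ * K₂ * (L ^ 10)⁻¹ := by
    field_simp
  have h1310 : (L ^ 13)⁻¹ ≤ (L ^ 10)⁻¹ := by
    rw [inv_le_inv₀ (by positivity) (by positivity)]
    exact pow_le_pow_right₀ hL1 (by norm_num)
  have step2 : w₁ * K₁ * (L ^ 13)⁻¹ + w₂ * K₂ * (L ^ 10)⁻¹ ≤ K * (L ^ 10)⁻¹ := by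
    rw [hK, add_mul]
    have : w₁ * K₁ * (L ^ 13)⁻¹ ≤ w₁ * K₁ * (L ^ 10)⁻¹ :=
      mul_le_mul_of_nonneg_left h1310 (by positivity)
    linarith
  have hKle' : K ≤ ε * π * L := by
    have := hLX
    rwa [div_le_iff₀ (by positivity), mul_comm] at this
  have step3 : K * (L ^ 10)⁻¹ ≤ ε * (π / L ^ 9) := by
    rw [show ε * (π / L ^ 9) = (ε * π * L) * (L ^ 10)⁻¹ by field_simp]
    gcongr
  calc W₁ * A₁ + W₂ * A₂ ≤ _ := step1
    _ = w₁ * K₁ * (L ^ 13)⁻¹ + w₂ * K₂ * (L ^ 10)⁻¹ := by rw [e1, e2]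
    _ ≤ K * (L ^ 10)⁻¹ := step2
    _ ≤ ε * (π / L ^ 9) := step3

/-- The final numeric step for the WEIGHTED window clause of record (RT-01′/R-26: window tolerance
`C·𝓛(1 + log T)⁴/log P·R`, `log T = 𝓛^{1.1}`, `log P = 𝓛⁹`): with main weights `W₁ ≤ e^{256}(2 + 𝓛⁹)`,
main coefficient `A₁ ≤ K₁𝓛⁻²²`, SHARP window mass `W₂ ≤ e^{256}(5 + 𝓛^{1.1})` and window coefficient
`A₂ ≤ K_a·(𝓛(1 + 𝓛^{1.1})⁴/𝓛⁹)·𝓛⁻⁷ + K_b𝓛⁻¹⁴`, the total is `≤ επ𝓛⁻⁹` once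
`𝓛 ≥ 2(3e^{256}K₁ + 6e^{256}K_b)/(επ)` and `𝓛 ≥ (320e^{256}K_a/(επ))²` (the window term is
`≪ 𝓛^{1.1}·𝓛^{5.5}·𝓛⁻¹⁶ = 𝓛^{−9.5+0.1}`… precisely `160e^{256}K_a𝓛^{5.5}𝓛⁻¹⁵`, margin `𝓛^{1/2}`).
[cite: Zhang2022LandauSiegel, §10 p. 57] -/
theorem final_bound_D3 {L ε K₁ Ka Kb W₁ W₂ A₁ A₂ : ℝ} (hL1 : 1 ≤ L) (hε : 0 < ε)
    (hK₁ : 0 ≤ K₁) (hKa : 0 ≤ Ka) (hKb : 0 ≤ Kb) (hA₁0 : 0 ≤ A₁) (hA₂0 : 0 ≤ A₂)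
    (hW₁ : W₁ ≤ Real.exp 256 * (2 + L ^ 9))
    (hW₂ : W₂ ≤ Real.exp 256 * (5 + L ^ (1.1 : ℝ)))
    (hA₁ : A₁ ≤ K₁ * (L ^ 22)⁻¹)
    (hA₂ : A₂ ≤ Ka * (L * (1 + L ^ (1.1 : ℝ)) ^ 4 / L ^ 9) * (L ^ 7)⁻¹ + Kb * (L ^ 14)⁻¹)
    (hLX₁ : 2 * (3 * Real.exp 256 * K₁ + 6 * Real.exp 256 * Kb) / (ε * π) ≤ L)
    (hLX₂ : (2 * (160 * Real.exp 256 * Ka) / (ε * π)) ^ 2 ≤ L) :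
    W₁ * A₁ + W₂ * A₂ ≤ ε * (π / L ^ 9) := by
  have hL0 : 0 < L := by linarith
  have hπ := Real.pi_pos
  have he := Real.exp_pos 256
  set τ : ℝ := L ^ (1.1 : ℝ) with hτ
  have hτ0 : 0 ≤ τ := Real.rpow_nonneg hL0.le _
  have hτ1 : 1 ≤ τ := Real.one_le_rpow hL1 (by norm_num)
  have hτL2 : τ ≤ L ^ 2 := by
    rw [hτ, ← Real.rpow_natCast L 2]
    exact Real.rpow_le_rpow_of_exponent_le hL1 (by norm_num)
  have hτ5 : τ ^ 5 = L ^ (5.5 : ℝ) := by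
    rw [hτ, ← Real.rpow_natCast, ← Real.rpow_mul hL0.le]; norm_num
  have hL6 : L ^ (5.5 : ℝ) * L ^ (0.5 : ℝ) = L ^ 6 := by
    rw [← Real.rpow_add hL0, ← Real.rpow_natCast L 6]; norm_num
  have hL55 : 0 < L ^ (5.5 : ℝ) := Real.rpow_pos_of_pos hL0 _
  -- the square-root margin
  set M : ℝ := 2 * (160 * Real.exp 256 * Ka) / (ε * π) with hM
  have hM0 : 0 ≤ M := by positivity
  have hMsqrt : M ≤ L ^ (0.5 : ℝ) := by
    have h1 : M = Real.sqrt (M ^ 2) := (Real.sqrt_sq hM0).symm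
    rw [h1, show (0.5 : ℝ) = 1 / 2 by norm_num, ← Real.sqrt_eq_rpow]
    exact Real.sqrt_le_sqrt hLX₂
  -- window polynomial in `τ`
  have hpoly1 : (5 + τ) * (1 + τ) ^ 4 ≤ 160 * τ ^ 5 := by
    have h2 : 1 + τ ≤ 2 * τ := by linarith
    have h3 : (1 + τ) ^ 5 ≤ (2 * τ) ^ 5 := pow_le_pow_left₀ (by linarith) h2 5
    have h4 : (5 + τ) * (1 + τ) ^ 4 ≤ 5 * (1 + τ) ^ 5 := by nlinarith [pow_nonneg (by linarith : (0:ℝ) ≤ 1 + τ) 4]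
    nlinarith
  have hpoly2 : 5 + τ ≤ 6 * L ^ 2 := by nlinarith
  -- the two pieces
  have hW₁' : W₁ ≤ 3 * Real.exp 256 * L ^ 9 := by
    refine hW₁.trans ?_
    have h9 : (1 : ℝ) ≤ L ^ 9 := one_le_pow₀ hL1
    nlinarith
  have hW₂0 : 0 ≤ Real.exp 256 * (5 + τ) := by positivity
  have piece1 : W₁ * A₁ ≤ 3 * Real.exp 256 * K₁ * (L ^ 12)⁻¹ := by
    calc W₁ * A₁ ≤ (3 * Real.exp 256 * L ^ 9) * (K₁ * (L ^ 22)⁻¹) := by gcongr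
      _ = 3 * Real.exp 256 * K₁ * (L ^ 13)⁻¹ := by field_simp
      _ ≤ 3 * Real.exp 256 * K₁ * (L ^ 12)⁻¹ := by
          gcongr _ * ?_
          rw [inv_le_inv₀ (by positivity) (by positivity)]
          exact pow_le_pow_right₀ hL1 (by norm_num)
  have piece2 : W₂ * A₂ ≤ 160 * Real.exp 256 * Ka * L ^ (5.5 : ℝ) * (L ^ 15)⁻¹ +
      6 * Real.exp 256 * Kb * (L ^ 12)⁻¹ := by
    calc W₂ * A₂ ≤ (Real.exp 256 * (5 + τ)) *
          (Ka * (L * (1 + τ) ^ 4 / L ^ 9) * (L ^ 7)⁻¹ + Kb * (L ^ 14)⁻¹) := by gcongr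
      _ = Real.exp 256 * Ka * ((5 + τ) * (1 + τ) ^ 4) * (L * (L ^ 9)⁻¹ * (L ^ 7)⁻¹) +
            Real.exp 256 * Kb * (5 + τ) * (L ^ 14)⁻¹ := by ring
      _ ≤ Real.exp 256 * Ka * (160 * τ ^ 5) * (L * (L ^ 9)⁻¹ * (L ^ 7)⁻¹) +
            Real.exp 256 * Kb * (6 * L ^ 2) * (L ^ 14)⁻¹ := by gcongr
      _ = 160 * Real.exp 256 * Ka * τ ^ 5 * (L ^ 15)⁻¹ +
            6 * Real.exp 256 * Kb * (L ^ 12)⁻¹ := by field_simp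
      _ = _ := by rw [hτ5]
  -- endgame
  have hLX₁' : 3 * Real.exp 256 * K₁ + 6 * Real.exp 256 * Kb ≤ ε * π * L / 2 := by
    have := hLX₁; rw [div_le_iff₀ (by positivity)] at this; linarith
  have hL3 : L ≤ L ^ 3 := by
    calc L = L ^ 1 := (pow_one _).symm
      _ ≤ L ^ 3 := pow_le_pow_right₀ hL1 (by norm_num)
  have part1 : 3 * Real.exp 256 * K₁ * (L ^ 12)⁻¹ + 6 * Real.exp 256 * Kb * (L ^ 12)⁻¹ ≤
      ε / 2 * (π / L ^ 9) := by
    rw [← add_mul, show ε / 2 * (π / L ^ 9) = (ε * π * L ^ 3 / 2) * (L ^ 12)⁻¹ by field_simp]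
    refine mul_le_mul_of_nonneg_right ?_ (by positivity)
    calc 3 * Real.exp 256 * K₁ + 6 * Real.exp 256 * Kb ≤ ε * π * L / 2 := hLX₁'
      _ ≤ ε * π * L ^ 3 / 2 := by gcongr
  have part2 : 160 * Real.exp 256 * Ka * L ^ (5.5 : ℝ) * (L ^ 15)⁻¹ ≤ ε / 2 * (π / L ^ 9) := by
    have hM' : 160 * Real.exp 256 * Ka = ε * π * M / 2 := by rw [hM]; field_simp
    rw [show ε / 2 * (π / L ^ 9) = (ε * π / 2 * L ^ 6) * (L ^ 15)⁻¹ by field_simp]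
    refine mul_le_mul_of_nonneg_right ?_ (by positivity)
    rw [hM', ← hL6]
    calc ε * π * M / 2 * L ^ (5.5 : ℝ) = (ε * π / 2 * L ^ (5.5 : ℝ)) * M := by ring
      _ ≤ (ε * π / 2 * L ^ (5.5 : ℝ)) * L ^ (0.5 : ℝ) := by gcongr
      _ = ε * π / 2 * (L ^ (5.5 : ℝ) * L ^ (0.5 : ℝ)) := by ring
  linarith [piece1, piece2, part1, part2]

/-! ## The main step: `Z22:§10.u037`, first line, from the relative clauses -/

variable {c' : ℝ}

set_option maxHeartbeats 400000 in -- one long assembly (as the tree's `Skeleton.eq1038a_of`)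
/-- **`Z22:§10.u037` (first line) from the RELATIVE Lemma 10.2.** The typed display
`Typed.Sec10B.Eq1037a c′` FOLLOWS (kernel-checked) from: clause (10.9) of Lemma 10.2 in relative form
(tolerance `C𝓛⁻¹⁵(∏_{q∣dr}(1−q⁻¹)⁻¹)²` on `P^{0.5} < dr ≤ P^{0.502}/T`, spelled as clause 2 of
`Skeleton.Lemma102Rel`), the window clause (10.11) in weighted form
(`‖𝔳₂ⱼ(d,r)‖ ≤ C𝓛(1 + log T)⁴/log P·(∏_{q∣dr}(1−q⁻¹)⁻¹)²` on the three `T`-windows — the derivable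
reading of record, R-26), Lemma 8.2 (`Skeleton.Lemma82 c′`)
and (8.10) (`Section8cStatements.Eq810`) — all CLAIMS of the manuscript (or their repaired readings of
record) taken as hypotheses. Same skeleton as sz-d41's `Skeleton.eq1037a_of`; the relative factor
`(n/φ(n))²` is absorbed by the exponent-7 window weights, the weak window tolerance by the sharp
window mass `e^{256}(5 + 𝓛^{1.1})`; error `O(𝓛^{−9.4}) = o(α)`.
[cite: Zhang2022LandauSiegel, §10 p. 57] -/
theorem eq1037a_of_clauses
    (h9 : ∃ C : ℝ, ForAllLarge fun D _ χ => AssumptionA D χ →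
      ∀ j ∈ ({1, 2, 3} : Finset ℕ), ∀ d r : ℕ, 1 ≤ d → 1 ≤ r →
        bigP D ^ (0.5 : ℝ) < ((d * r : ℕ) : ℝ) → ((d * r : ℕ) : ℝ) ≤ bigP D ^ (0.502 : ℝ) / bigT D →
        ‖frakv2 c' χ j d r - 500 * deriv χ.LFunction 1 * PiW χ d r / Real.log (bigP D) *
            (-1 + fraky1 c' D j ((d * r : ℕ) : ℝ))‖ ≤
          C * (ell D ^ 15)⁻¹ * (∏ q ∈ (d * r).primeFactors, (1 - (q : ℝ)⁻¹)⁻¹) ^ 2)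
    (hW : ∃ C : ℝ, ForAllLarge fun D _ χ => AssumptionA D χ →
      ∀ j ∈ ({1, 2, 3} : Finset ℕ), ∀ d r : ℕ, 1 ≤ d → 1 ≤ r →
        ((bigP D ^ (0.5 : ℝ) / bigT D < ((d * r : ℕ) : ℝ) ∧ ((d * r : ℕ) : ℝ) ≤ bigP D ^ (0.5 : ℝ)) ∨
            (bigP D ^ (0.502 : ℝ) / bigT D < ((d * r : ℕ) : ℝ) ∧
              ((d * r : ℕ) : ℝ) ≤ bigP D ^ (0.502 : ℝ)) ∨
            (bigP D ^ (0.504 : ℝ) / bigT D < ((d * r : ℕ) : ℝ) ∧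
              ((d * r : ℕ) : ℝ) < bigP D ^ (0.504 : ℝ))) →
        ‖frakv2 c' χ j d r‖ ≤
          C * (ell D * (1 + ell D ^ (1.1 : ℝ)) ^ 4 * (ell D ^ 9)⁻¹) *
            (∏ q ∈ (d * r).primeFactors, (1 - (q : ℝ)⁻¹)⁻¹) ^ 2)
    (h82 : Lemma82 c') (h810 : Section8cStatements.Eq810) : Sec10B.Eq1037a c' := by
  classical
  intro ε hε
  obtain ⟨C₁, H₁⟩ := h9
  obtain ⟨Cw, HW⟩ := hW
  obtain ⟨C₂, H₂⟩ := h82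
  -- one constant for both Lemma-10.2 clauses
  set C₀ : ℝ := max |C₁| |Cw| with hC₀
  have hC₀1 : |C₁| ≤ C₀ := le_max_left _ _
  have hC₀w : |Cw| ≤ C₀ := le_max_right _ _
  have hC₀0 : 0 ≤ C₀ := le_trans (abs_nonneg _) hC₀1
  have hC₀abs : |C₀| = C₀ := abs_of_nonneg hC₀0
  -- the final constants (as in `Skeleton.eq1037a_of`, with `C₀` for `C₁`)
  set K₁ : ℝ := (254 * Real.exp (9 / 2) + 2 * |C₂|) * |C₀| + 8000 * Real.exp (9 / 2) * |C₂|
    with hK₁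
  -- the window constants: `κ` bounds both `(B_M + e_M)𝓛⁷` and `B_M|c₀|·2·𝓛¹⁴` (from `consts_bound`)
  set κ : ℝ := (254 * Real.exp (9 / 2) + 2 * |C₂|) * |(1 : ℝ)| +
    1016000 * (Real.exp (9 / 2) * Real.exp (9 / 2)) with hκ
  have hκ0 : 0 ≤ κ := by positivity
  have hK₁0 : 0 ≤ K₁ := by positivity
  set X : ℝ := 2 * (3 * Real.exp 256 * K₁ + 6 * Real.exp 256 * κ) / (ε * π) +
    (2 * (160 * Real.exp 256 * (κ * |C₀|)) / (ε * π)) ^ 2 + 5 with hX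
  obtain ⟨D₀, hH⟩ := (H₁.and HW).and H₂
  refine ⟨max D₀ (max ⌈Real.exp (π * |c'| + 5)⌉₊ ⌈Real.exp X⌉₊), fun D _ χ hD hq hp hA j hj => ?_⟩
  have hD₀ : D₀ ≤ D := le_trans (le_max_left _ _) hD
  have hDc : ⌈Real.exp (π * |c'| + 5)⌉₊ ≤ D :=
    le_trans (le_trans (le_max_left _ _) (le_max_right _ _)) hD
  have hDX : ⌈Real.exp X⌉₊ ≤ D := le_trans (le_trans (le_max_right _ _) (le_max_right _ _)) hD
  obtain ⟨hL5, hα, hcαL⟩ := large_D hDc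
  have hLX : X ≤ ell D := by
    have h : Real.exp X ≤ D := le_trans (Nat.le_ceil _) (by exact_mod_cast hDX)
    rw [ell]; exact (Real.le_log_iff_exp_le (lt_of_lt_of_le (Real.exp_pos _) h)).mpr h
  obtain ⟨⟨H₁', HW'⟩, H₂'⟩ := hH D χ hD₀ hq hp
  replace H₁' := H₁' hA j hj
  replace HW' := HW' hA j hj
  replace H₂' := H₂' hA j hj 6 (by simp)
  ------------------------------------------------------------------
  -- parameters
  ------------------------------------------------------------------
  have hlog2 : 2 ≤ Real.log D := by have h := hL5; rw [ell] at h; linarith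
  have hL3 : (3 : ℝ) ≤ ell D := by linarith
  have hL1 : (1 : ℝ) ≤ ell D := by linarith
  have hL0 : (0 : ℝ) < ell D := by linarith
  have hαeq : alpha D = π / ell D ^ 9 := by rw [alpha, bigP, Real.log_exp]
  have hαL : alpha D * ell D ^ 9 = π := by rw [hαeq]; field_simp
  obtain ⟨hhiN, hP2lo, hT1, hP1⟩ := range_sizes (D := D) hlog2
  have hMT0 := mainTerm_eq c' χ hlog2 j
  have hreidx0 := drSum_reindex c' χ j (Sec10B.mSum11 c' χ j) (Sec10B.nSum13 c' χ j)
    (lo := bigP D ^ (0.5 : ℝ)) hhiN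
  -- the exponent-7 weights of the good range and of its windows (sz-d33)
  have hWgood := Sj1321Mid.weight_good_le (D := D) hL3
  have hWtop := Sj1321Mid.weight_top_le (D := D) hL3
  set P : ℝ := bigP D with hPdef
  set lo : ℝ := bigP D ^ (0.5 : ℝ) with hlodef
  set hi : ℝ := bigP D ^ (0.502 : ℝ) with hhidef
  set T : ℝ := bigT D with hTdef
  have hlo_exp : lo = Real.exp (0.5 * ell D ^ 9) := bigP_rpow D 0.5
  have hhi_exp : hi = Real.exp (0.502 * ell D ^ 9) := bigP_rpow D 0.502
  have hP1_exp : Skeleton.P1 D = Real.exp (0.504 * ell D ^ 9) := bigP_rpow D 0.504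
  have hlogP : Real.log P = ell D ^ 9 := log_bigP D
  have hT_exp : T = Real.exp (ell D ^ (1.1 : ℝ)) := rfl
  set M : ℕ → ℂ := Sec10B.mSum11 c' χ j with hMdef
  set N : ℕ → ℕ → ℂ := Sec10B.nSum13 c' χ j with hNdef
  set S : Finset ℕ := (Finset.Ico 1 (Nsupp D)).filter (fun n : ℕ => lo ≤ (n : ℝ) ∧ (n : ℝ) < hi)
    with hSdef
  clear_value P lo hi T M N S
  have hP0 : 0 < P := lt_trans zero_lt_one hP1
  have hlo0 : 0 < lo := by rw [hlo_exp]; exact Real.exp_pos _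
  have hhi0 : 0 < hi := by rw [hhi_exp]; exact Real.exp_pos _
  have hT0 : 0 < T := lt_of_lt_of_le zero_lt_one hT1
  have hT1' : 1 < T := by
    rw [hT_exp]; exact Real.one_lt_exp_iff.mpr (Real.rpow_pos_of_pos hL0 _)
  have hP1pos : 0 < Skeleton.P1 D := by rw [hP1_exp]; exact Real.exp_pos _
  have hlogP1 : Real.log (Skeleton.P1 D) = 0.504 * ell D ^ 9 := by rw [hP1_exp, Real.log_exp]
  have hlogP1pos : 0 < Real.log (Skeleton.P1 D) := by rw [hlogP1]; positivity
  have hlogT : Real.log T = ell D ^ (1.1 : ℝ) := by rw [hT_exp, Real.log_exp]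
  have hhiT_exp : hi / T = Real.exp (0.502 * ell D ^ 9 - ell D ^ (1.1 : ℝ)) := by
    rw [hhi_exp, hT_exp, ← Real.exp_sub]
  obtain ⟨h11, -⟩ := bigT_lt_rpow hL5
  have h59 : (1953125 : ℝ) ≤ ell D ^ 9 := by
    have h := pow_le_pow_left₀ (by norm_num : (0:ℝ) ≤ 5) hL5 9
    norm_num at h
    exact h
  have h7L : (78125 : ℝ) * ell D ^ 2 ≤ ell D ^ 9 := by
    have hL7 : (78125 : ℝ) ≤ ell D ^ 7 := by
      have h := pow_le_pow_left₀ (by norm_num : (0:ℝ) ≤ 5) hL5 7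
      norm_num at h
      exact h
    calc (78125 : ℝ) * ell D ^ 2 ≤ ell D ^ 7 * ell D ^ 2 := by gcongr
      _ = ell D ^ 9 := by ring
  -- the objects of the abstract assembly (opaque names with defining equations)
  obtain ⟨a, hadef⟩ : ∃ a : ℕ → ℂ, a = fun n : ℕ => (‖χ (n : ZMod D)‖ : ℂ) * lamZero c' D j n / (n : ℂ) :=
    ⟨_, rfl⟩
  obtain ⟨M₀, hM₀def⟩ : ∃ M₀ : ℕ → ℂ, M₀ = fun n : ℕ => deriv χ.LFunction 1 *
      frakfW c' D j 6 (Skeleton.P1 D / n) / (Real.log (Skeleton.P1 D) : ℂ) := ⟨_, rfl⟩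
  obtain ⟨G, hGdef⟩ : ∃ G : ℕ → ℂ, G = fun n : ℕ => -1 + fraky1 c' D j n := ⟨_, rfl⟩
  obtain ⟨c₀, hc₀def⟩ : ∃ c₀ : ℂ, c₀ = 500 * deriv χ.LFunction 1 / (Real.log P : ℂ) := ⟨_, rfl⟩
  obtain ⟨main, hmaindef⟩ : ∃ main : ℕ → Prop, main = fun n : ℕ => lo < (n : ℝ) ∧ (n : ℝ) ≤ hi / T :=
    ⟨_, rfl⟩
  have hmemS : ∀ {n : ℕ}, n ∈ S → 1 ≤ n ∧ lo ≤ (n : ℝ) ∧ (n : ℝ) < hi := by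
    intro n hn
    rw [hSdef, Finset.mem_filter, Finset.mem_Ico] at hn
    exact ⟨hn.1.1, hn.2.1, hn.2.2⟩
  have hSne : ∀ n ∈ S, n ≠ 0 := fun n hn => by have := (hmemS hn).1; omega
  -- the relative factor at `n = (n/r)·r`
  have hrel : ∀ {n : ℕ}, n ∈ S → ∀ r ∈ n.divisors,
      (∏ q ∈ (n / r * r).primeFactors, (1 - (q : ℝ)⁻¹)⁻¹) ^ 2 = ((n : ℝ) / Nat.totient n) ^ 2 := by
    intro n hn r hr
    rw [Nat.div_mul_cancel (Nat.mem_divisors.mp hr).1]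
    exact Sj1321Mid.prod_one_sub_inv_inv_sq_eq (hSne n hn)
  -- (A) re-indexing
  have hreidx : Sec10B.drSum c' χ j M N lo hi =
      ∑ n ∈ S, ∑ r ∈ n.divisors,
        (if Squarefree r then a n / (Nat.totient r : ℂ) * M n * N (n / r) r else 0) := by
    rw [hadef]; exact hreidx0
  -- (B) hypotheses of the abstract assembly
  have hμ6 : betaMu D 6 = beta6 D := by simp [betaMu]
  have hxfacts : ∀ {n : ℕ}, n ∈ S →
      T < Skeleton.P1 D / n ∧ Skeleton.P1 D / n < P ∧ |Real.log (Skeleton.P1 D / n)| ≤ ell D ^ 9 ∧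
      |Real.log (n / lo)| ≤ 0.004 * ell D ^ 9 ∧ |Real.log (Skeleton.P1 D / n)| ≤ 0.004 * ell D ^ 9 ∧
      |Real.log (hi / n)| ≤ 0.004 * ell D ^ 9 := by
    intro n hn
    obtain ⟨hn1, hlon, hnhi⟩ := hmemS hn
    rw [hlodef] at hlon ⊢
    rw [hhidef] at hnhi ⊢
    rw [hTdef, hPdef]
    exact range_xfacts hL5 hn1 hlon hnhi
  have hLp : ‖deriv χ.LFunction 1‖ ≤ 4 * Real.exp (9 / 2) * ell D ^ 2 :=
    norm_deriv_LFunction_one_le χ (by linarith) hp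
  -- (B1) `M = M₀ + O(eM)` on the whole range
  have hMall : ∀ n ∈ S, ‖M n - M₀ n‖ ≤ |C₂| * (ell D ^ 6)⁻¹ / (0.504 * ell D ^ 9) := by
    intro n hn
    obtain ⟨hn1, hlon, hnhi⟩ := hmemS hn
    obtain ⟨hTx, hxP, -, -, -, -⟩ := hxfacts hn
    have hP2n : Skeleton.P2 D ≤ (n : ℝ) := hP2lo.trans hlon
    have hMn : M n = (1 / (Real.log (Skeleton.P1 D) : ℂ)) * ∑ m ∈ Finset.Ico 1 ⌈Skeleton.P1 D / n⌉₊,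
        χ (m : ZMod D) / (m : ℂ) ^ (1 - betaJ c' D j) *
          (((Skeleton.P1 D / n) / m : ℝ) : ℂ) ^ beta6 D * (Real.log ((Skeleton.P1 D / n) / m) : ℂ) := by
      rw [hMdef]; exact mSum11_eq c' χ hlog2 j hn1 hP2n
    have h82 := H₂' (Skeleton.P1 D / n) hTx hxP
    rw [hμ6] at h82
    have hdiff : M n - M₀ n = (1 / (Real.log (Skeleton.P1 D) : ℂ)) *
        ((∑ m ∈ Finset.Ico 1 ⌈Skeleton.P1 D / n⌉₊, χ (m : ZMod D) / (m : ℂ) ^ (1 - betaJ c' D j) *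
          (((Skeleton.P1 D / n) / m : ℝ) : ℂ) ^ beta6 D * (Real.log ((Skeleton.P1 D / n) / m) : ℂ)) -
          deriv χ.LFunction 1 * frakfW c' D j 6 (Skeleton.P1 D / n)) := by
      rw [hMn, hM₀def]
      have : (Real.log (Skeleton.P1 D) : ℂ) ≠ 0 := by exact_mod_cast hlogP1pos.ne'
      field_simp
    rw [hdiff, norm_mul, norm_div, norm_one, Complex.norm_real, Real.norm_of_nonneg hlogP1pos.le,
      hlogP1]
    have h82' := h82.trans (mul_le_mul_of_nonneg_right (le_abs_self C₂) (by positivity))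
    calc 1 / (0.504 * ell D ^ 9) * _ ≤ 1 / (0.504 * ell D ^ 9) * (|C₂| * (ell D ^ 6)⁻¹) := by
          gcongr
      _ = |C₂| * (ell D ^ 6)⁻¹ / (0.504 * ell D ^ 9) := by ring
  have hM : ∀ n ∈ S, main n → ‖M n - M₀ n‖ ≤ |C₂| * (ell D ^ 6)⁻¹ / (0.504 * ell D ^ 9) :=
    fun n hn _ => hMall n hn
  -- (B2) `|M₀| ≤ BM`
  have hM₀ : ∀ n ∈ S, ‖M₀ n‖ ≤ 4 * Real.exp (9 / 2) * ell D ^ 2 * 32 / (0.504 * ell D ^ 9) := by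
    intro n hn
    obtain ⟨-, -, hlx, -, -, -⟩ := hxfacts hn
    have hf := norm_frakfW_six_le hcαL hα hαL hL0.le j hlx
    rw [hM₀def]
    simp only
    rw [norm_div, norm_mul, Complex.norm_real, Real.norm_of_nonneg hlogP1pos.le, hlogP1]
    gcongr
  -- (B2') `|M| ≤ BM + eM` on the windows
  have hMW : ∀ n ∈ S, ¬ main n → ‖M n‖ ≤
      4 * Real.exp (9 / 2) * ell D ^ 2 * 32 / (0.504 * ell D ^ 9) +
        |C₂| * (ell D ^ 6)⁻¹ / (0.504 * ell D ^ 9) := by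
    intro n hn _
    have h2 : ‖M n‖ ≤ ‖M₀ n‖ + ‖M n - M₀ n‖ := norm_le_norm_add_norm_sub' (M n) (M₀ n)
    linarith [hMall n hn, hM₀ n hn]
  -- (B3) `|G| ≤ 2`
  have hG : ∀ n ∈ S, ‖G n‖ ≤ 2 := by
    intro n hn
    obtain ⟨-, -, -, h1, h2, h3⟩ := hxfacts hn
    rw [hlodef] at h1
    rw [hhidef] at h3
    rw [hGdef]
    exact norm_fraky1_sub_le hcαL hα hαL hL0.le j h1 h2 h3
  -- (B4) main `n`: Lemma 10.2 (10.9), RELATIVE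
  have hN : ∀ n ∈ S, main n → ∀ r ∈ n.divisors, Squarefree r →
      ‖N (n / r) r - c₀ * PiW χ (n / r) r * G n‖ ≤
        |C₀| * (ell D ^ 15)⁻¹ * ((n : ℝ) / Nat.totient n) ^ 2 := by
    intro n hn hmain r hr _
    obtain ⟨hn1, -, -⟩ := hmemS hn
    have hr0 : 0 < r := Nat.pos_of_mem_divisors hr
    have hrn : r ∣ n := (Nat.mem_divisors.mp hr).1
    have hnr : n / r * r = n := Nat.div_mul_cancel hrn
    have hd1 : 1 ≤ n / r := Nat.div_pos (Nat.le_of_dvd (by omega) hrn) hr0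
    have hcast : ((n / r * r : ℕ) : ℝ) = n := by rw [hnr]
    have hNeq : N (n / r) r = frakv2 c' χ j (n / r) r := by
      rw [hNdef]; exact nSum13_eq_frakv2 c' χ hlog2 j hd1 hr0
    have hmain' : lo < (n : ℝ) ∧ (n : ℝ) ≤ hi / T := by rw [hmaindef] at hmain; exact hmain
    have h := (H₁' (n / r) r hd1 hr0) (by rw [hcast]; exact hmain'.1)
      (by rw [hcast]; exact hmain'.2)
    rw [hrel hn r hr, hcast] at h
    rw [hNeq, hGdef, hc₀def]
    simp only
    refine le_trans (le_of_eq ?_) (h.trans ?_)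
    · congr 1; ring
    · have h15 : 0 ≤ (ell D ^ 15)⁻¹ * ((n : ℝ) / Nat.totient n) ^ 2 := by positivity
      calc C₁ * (ell D ^ 15)⁻¹ * ((n : ℝ) / Nat.totient n) ^ 2
          = C₁ * ((ell D ^ 15)⁻¹ * ((n : ℝ) / Nat.totient n) ^ 2) := by ring
        _ ≤ |C₀| * ((ell D ^ 15)⁻¹ * ((n : ℝ) / Nat.totient n) ^ 2) :=
            mul_le_mul_of_nonneg_right ((le_abs_self _).trans (hC₀1.trans (le_abs_self _))) h15
        _ = |C₀| * (ell D ^ 15)⁻¹ * ((n : ℝ) / Nat.totient n) ^ 2 := by ring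
  -- (B5) window `n`: Lemma 10.2 (10.11), WEIGHTED
  have hWn : ∀ n ∈ S, ¬ main n → ∀ r ∈ n.divisors, Squarefree r →
      ‖N (n / r) r‖ ≤ |C₀| * (ell D * (1 + ell D ^ (1.1 : ℝ)) ^ 4 * (ell D ^ 9)⁻¹) *
        ((n : ℝ) / Nat.totient n) ^ 2 := by
    intro n hn hmain r hr _
    obtain ⟨hn1, hlon, hnhi⟩ := hmemS hn
    have hr0 : 0 < r := Nat.pos_of_mem_divisors hr
    have hrn : r ∣ n := (Nat.mem_divisors.mp hr).1
    have hnr : n / r * r = n := Nat.div_mul_cancel hrn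
    have hd1 : 1 ≤ n / r := Nat.div_pos (Nat.le_of_dvd (by omega) hrn) hr0
    have hcast : ((n / r * r : ℕ) : ℝ) = n := by rw [hnr]
    have hNeq : N (n / r) r = frakv2 c' χ j (n / r) r := by
      rw [hNdef]; exact nSum13_eq_frakv2 c' χ hlog2 j hd1 hr0
    have hwin : (lo / T < ((n / r * r : ℕ) : ℝ) ∧ ((n / r * r : ℕ) : ℝ) ≤ lo) ∨
        (hi / T < ((n / r * r : ℕ) : ℝ) ∧ ((n / r * r : ℕ) : ℝ) ≤ hi) ∨
        (P ^ (0.504 : ℝ) / T < ((n / r * r : ℕ) : ℝ) ∧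
          ((n / r * r : ℕ) : ℝ) < P ^ (0.504 : ℝ)) := by
      rw [hcast]
      rw [hmaindef] at hmain
      simp only [not_and_or, not_lt, not_le] at hmain
      rcases hmain with h | h
      · left
        refine ⟨?_, h⟩
        calc lo / T < lo := div_lt_self hlo0 hT1'
          _ ≤ n := hlon
      · right; left
        exact ⟨h, hnhi.le⟩
    have h := (HW' (n / r) r hd1 hr0) hwin
    rw [hrel hn r hr] at h
    rw [hNeq]
    refine h.trans ?_
    have h7 : 0 ≤ ell D * (1 + ell D ^ (1.1 : ℝ)) ^ 4 * (ell D ^ 9)⁻¹ * ((n : ℝ) / Nat.totient n) ^ 2 := by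
      have : 0 ≤ ell D ^ (1.1 : ℝ) := Real.rpow_nonneg hL0.le _
      positivity
    calc Cw * (ell D * (1 + ell D ^ (1.1 : ℝ)) ^ 4 * (ell D ^ 9)⁻¹) * ((n : ℝ) / Nat.totient n) ^ 2
        = Cw * (ell D * (1 + ell D ^ (1.1 : ℝ)) ^ 4 * (ell D ^ 9)⁻¹ * ((n : ℝ) / Nat.totient n) ^ 2) := by
          ring
      _ ≤ |C₀| * (ell D * (1 + ell D ^ (1.1 : ℝ)) ^ 4 * (ell D ^ 9)⁻¹ * ((n : ℝ) / Nat.totient n) ^ 2) :=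
          mul_le_mul_of_nonneg_right ((le_abs_self _).trans (hC₀w.trans (le_abs_self _))) h7
      _ = |C₀| * (ell D * (1 + ell D ^ (1.1 : ℝ)) ^ 4 * (ell D ^ 9)⁻¹) *
            ((n : ℝ) / Nat.totient n) ^ 2 := by ring
  -- (B6) the (8.10) collapse
  have hPi : ∀ n ∈ S, main n →
      ∑ r ∈ n.divisors with Squarefree r, (1 / (Nat.totient r : ℂ)) * PiW χ (n / r) r =
        (n : ℂ) / (Nat.totient n : ℂ) := fun n hn _ => h810 D χ hq n (hSne n hn)
  ------------------------------------------------------------------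
  -- (C) the abstract assembly, relative tolerances
  ------------------------------------------------------------------
  have heM0 : 0 ≤ |C₂| * (ell D ^ 6)⁻¹ / (0.504 * ell D ^ 9) := by positivity
  have hBM0 : 0 ≤ 4 * Real.exp (9 / 2) * ell D ^ 2 * 32 / (0.504 * ell D ^ 9) := by positivity
  haveI : DecidablePred main := fun n => by rw [hmaindef]; infer_instance
  have hRA := Sec10C.Ranges1422.range_assembly_bound₃ hSne main a M M₀ G N (PiW χ) c₀ heM0 hBM0
    (add_nonneg hBM0 heM0) hPi hM hM₀ hMW hG hN hWn
  ------------------------------------------------------------------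
  -- (D) main term, weights, constants
  ------------------------------------------------------------------
  have hMT : 500 * deriv χ.LFunction 1 ^ 2 / (0.504 * Sec10B.logP D ^ 2) *
        Sec10B.nAvg c' χ j lo hi
          (fun n => frakfW c' D j 6 (P ^ (0.504 : ℝ) / n) * (-1 + fraky1 c' D j n)) =
      ∑ n ∈ S, a n * ((n : ℂ) / (Nat.totient n : ℂ)) * (M₀ n * c₀ * G n) := by
    rw [hadef, hM₀def, hGdef, hc₀def]
    exact hMT0
  set w : ℕ → ℝ := fun n => ((n : ℝ) / Nat.totient n) ^ 7 / n with hw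
  have hw0 : ∀ n, 0 ≤ w n := fun n => by rw [hw]; positivity
  have hweight : ∀ n ∈ S, ‖a n‖ * ((n : ℝ) / Nat.totient n) ^ 3 ≤ w n := by
    intro n hn
    have hn0 := hSne n hn
    have hχ : ‖χ (n : ZMod D)‖ ≤ 1 := DirichletCharacter.norm_le_one χ _
    have hlam := norm_lamZero_le c' D j hn0
    have hr1 := one_le_self_div_totient hn0
    rw [hadef, hw]
    simp only
    rw [norm_div, norm_mul, Complex.norm_real, Real.norm_eq_abs, abs_norm, Complex.norm_natCast]
    calc ‖χ (n : ZMod D)‖ * ‖lamZero c' D j n‖ / n * ((n : ℝ) / Nat.totient n) ^ 3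
        ≤ 1 * ((n : ℝ) / Nat.totient n) ^ 4 / n * ((n : ℝ) / Nat.totient n) ^ 3 := by gcongr
      _ = ((n : ℝ) / Nat.totient n) ^ 7 / n := by ring
  -- main part ⊆ `Ioc ⌊P^{0.5}⌋ ⌊P^{0.502}/T⌋`
  have hWmain_le : ∑ n ∈ S.filter main, ‖a n‖ * ((n : ℝ) / Nat.totient n) ^ 3 ≤
      Real.exp 256 * (2 + ell D ^ 9) := by
    calc ∑ n ∈ S.filter main, ‖a n‖ * ((n : ℝ) / Nat.totient n) ^ 3
        ≤ ∑ n ∈ S.filter main, w n :=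
          Finset.sum_le_sum fun n hn => hweight n (Finset.mem_of_mem_filter n hn)
      _ ≤ ∑ n ∈ Finset.Ioc ⌊lo⌋₊ ⌊hi / T⌋₊, w n := by
          refine Finset.sum_le_sum_of_subset_of_nonneg ?_ fun n _ _ => hw0 n
          intro n hn
          rw [Finset.mem_filter] at hn
          obtain ⟨-, hmn⟩ := hn
          rw [hmaindef] at hmn
          obtain ⟨hg1, hg2⟩ := hmn
          rw [Finset.mem_Ioc]
          exact ⟨(Nat.floor_lt hlo0.le).mpr hg1, Nat.le_floor hg2⟩
      _ ≤ Real.exp 256 * (2 + ell D ^ 9) := hWgood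
  -- window part: the point `n = P^{0.5}` and the window `P^{0.502}/T < n < P^{0.502}`, SHARP mass
  have hWwin_le : ∑ n ∈ S.filter (fun n => ¬ main n), ‖a n‖ * ((n : ℝ) / Nat.totient n) ^ 3 ≤
      Real.exp 256 * (5 + ell D ^ (1.1 : ℝ)) := by
    have hwin := weight_sum_windows 7 (A := 0.5 * ell D ^ 9) (B := 0.502 * ell D ^ 9)
      (τ := ell D ^ (1.1 : ℝ)) (by linarith [h59]) (Real.rpow_nonneg hL0.le _)
      (by have h2pos : 0 < ell D ^ 2 := pow_pos hL0 2
          linarith [h11, h7L])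
      (S.filter (fun n => ¬ main n)) (fun n hn => by
        rw [Finset.mem_filter] at hn
        obtain ⟨hnS, hnm⟩ := hn
        obtain ⟨h1, h2, h3⟩ := hmemS hnS
        rw [hmaindef] at hnm
        simp only [not_and_or, not_lt, not_le] at hnm
        refine ⟨h1, ?_⟩
        rcases hnm with h | h
        · left; rw [← hlo_exp]; exact ⟨h2, h⟩
        · right
          rw [← hhiT_exp, ← hhi_exp]
          exact ⟨h.le, h3⟩)
    have h256 : Real.exp (2 ^ (7 + 1)) = Real.exp 256 := by norm_num
    rw [h256] at hwin
    calc ∑ n ∈ S.filter (fun n => ¬ main n), ‖a n‖ * ((n : ℝ) / Nat.totient n) ^ 3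
        ≤ ∑ n ∈ S.filter (fun n => ¬ main n), w n :=
          Finset.sum_le_sum fun n hn => hweight n (Finset.mem_of_mem_filter n hn)
      _ ≤ Real.exp 256 * (5 + ell D ^ (1.1 : ℝ)) := hwin
  have hc₀' : ‖c₀‖ ≤ 2000 * Real.exp (9 / 2) * (ell D ^ 7)⁻¹ := by
    rw [hc₀def, norm_div, norm_mul, Complex.norm_real, Real.norm_of_nonneg (by rw [hlogP]; positivity),
      hlogP]
    have h500 : ‖(500 : ℂ)‖ = 500 := by norm_num
    rw [h500, div_eq_mul_inv]
    have : (2000 : ℝ) * Real.exp (9 / 2) * (ell D ^ 7)⁻¹ =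
        500 * (4 * Real.exp (9 / 2) * ell D ^ 2) * (ell D ^ 9)⁻¹ := by
      field_simp; ring
    rw [this]
    gcongr
  obtain ⟨hKmain, -⟩ := consts_bound (C₁ := C₀) (C₂ := C₂) hL5 (norm_nonneg c₀) hc₀'
  obtain ⟨-, hκ'⟩ := consts_bound (C₁ := (1 : ℝ)) (C₂ := C₂) hL5 (norm_nonneg c₀) hc₀'
  rw [← hκ, abs_one, one_mul] at hκ'
  -- split `κ𝓛⁻¹⁴` into the two window pieces
  set BM : ℝ := 4 * Real.exp (9 / 2) * ell D ^ 2 * 32 / (0.504 * ell D ^ 9) with hBMdef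
  set eM : ℝ := |C₂| * (ell D ^ 6)⁻¹ / (0.504 * ell D ^ 9) with heMdef
  set eW : ℝ := |C₀| * (ell D * (1 + ell D ^ (1.1 : ℝ)) ^ 4 * (ell D ^ 9)⁻¹) with heWdef
  have hτ0 : 0 ≤ ell D ^ (1.1 : ℝ) := Real.rpow_nonneg hL0.le _
  have heW0 : 0 ≤ eW := by positivity
  have hBMc0 : 0 ≤ BM * ‖c₀‖ * 2 := by positivity
  have hsum7 : (BM + eM) * (ell D ^ 7)⁻¹ ≤ κ * (ell D ^ 14)⁻¹ := by
    have : (BM + eM) * (ell D ^ 7)⁻¹ + BM * ‖c₀‖ * 2 ≤ κ * (ell D ^ 14)⁻¹ := hκ'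
    linarith
  have hsum : BM + eM ≤ κ * (ell D ^ 7)⁻¹ := by
    have h14 : κ * (ell D ^ 14)⁻¹ = κ * (ell D ^ 7)⁻¹ * (ell D ^ 7)⁻¹ := by
      rw [mul_assoc, ← mul_inv, ← pow_add]
    rw [h14] at hsum7
    exact le_of_mul_le_mul_right hsum7 (by positivity)
  have hBc : BM * ‖c₀‖ * 2 ≤ κ * (ell D ^ 14)⁻¹ := by
    have h0 : 0 ≤ (BM + eM) * (ell D ^ 7)⁻¹ := by positivity
    have : (BM + eM) * (ell D ^ 7)⁻¹ + BM * ‖c₀‖ * 2 ≤ κ * (ell D ^ 14)⁻¹ := hκ'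
    linarith
  have hA₂ : (BM + eM) * eW + BM * ‖c₀‖ * 2 ≤
      κ * |C₀| * (ell D * (1 + ell D ^ (1.1 : ℝ)) ^ 4 / ell D ^ 9) * (ell D ^ 7)⁻¹ +
        κ * (ell D ^ 14)⁻¹ := by
    have h1 : (BM + eM) * eW ≤ κ * (ell D ^ 7)⁻¹ * eW := mul_le_mul_of_nonneg_right hsum heW0
    have h2 : κ * (ell D ^ 7)⁻¹ * eW =
        κ * |C₀| * (ell D * (1 + ell D ^ (1.1 : ℝ)) ^ 4 / ell D ^ 9) * (ell D ^ 7)⁻¹ := by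
      rw [heWdef]; ring
    linarith
  ------------------------------------------------------------------
  -- (E) conclusion
  ------------------------------------------------------------------
  rw [hreidx, hMT]
  refine hRA.trans ?_
  rw [hαeq]
  have hX₁ : 2 * (3 * Real.exp 256 * K₁ + 6 * Real.exp 256 * κ) / (ε * π) ≤ ell D := by
    rw [hX] at hLX
    linarith [sq_nonneg (2 * (160 * Real.exp 256 * (κ * |C₀|)) / (ε * π))]
  have hX₂ : (2 * (160 * Real.exp 256 * (κ * |C₀|)) / (ε * π)) ^ 2 ≤ ell D := by
    rw [hX] at hLX
    have : 0 ≤ 2 * (3 * Real.exp 256 * K₁ + 6 * Real.exp 256 * κ) / (ε * π) := by positivity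
    linarith
  exact final_bound_D3 hL1 hε hK₁0 (by positivity) hκ0 (by positivity) (by positivity)
    hWmain_le hWwin_le hKmain hA₂ hX₁ hX₂

/-- **`Z22:§10.u037` (first line) HOLDS** for the manuscript's parameter range `c′ ≥ 0`:
`Typed.Sec10B.Eq1037a c′` — every input of `eq1037a_of_clauses` is now a tree theorem: clause (10.9)
in relative form (`Lemma102.eq109Rel_of_lemma83Rel`, zl-w10-p6) and the weighted window bound
(`Lemma102.frakv2_windows_le_of_lemma83Rel`, zl-w10-p6) from Lemma 8.3 in relative form, itself a theorem
(`Skeleton.lemma83Rel_holds`, WP09); Lemma 8.2 (`Skeleton.lemma82_holds`) and (8.10) (`eq810_holds`).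
[cite: Zhang2022LandauSiegel, §10 p. 57] -/
theorem _root_.Literature.NumberTheory.LFunctions.Zhang2022.Typed.Sec10B.eq1037a_holds (hc' : 0 ≤ c') :
    Sec10B.Eq1037a c' :=
  eq1037a_of_clauses (Lemma102.eq109Rel_of_lemma83Rel (lemma83Rel_holds c'))
    (Lemma102.frakv2_windows_le_of_lemma83Rel (lemma83Rel_holds c')) (lemma82_holds hc')
    Section8FrontEnd810.eq810_holds

end Literature.NumberTheory.LFunctions.Zhang2022.Range1113Rel
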